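import Summits.KontsevichZagierPeriods.KontsevichZagierPeriods.Theorems.RootDecompRelativeModAbsoluteLogFoldingDegOne.Negative.Witness

/-!
# Negative knowledge for item `LogFoldingDegOne` (stmt-KontsevichZagierPeriods-29577), part 2

`not_logFoldingDegOne_of_logLinearDescent : LogLinearDescent → ¬ LogFoldingDegOne` — log-linear descent
(Kolchin–Ostrowski along the base + Baker at algebraic points; in the tree:
`LiouvilleUnfolding.LogPrimitiveNL.stub_descent stub_peelingStep stub_constRigidity`) refutes the
degree-one folding item.  Argument: if an ADMISSIBLE log term `T = [σ; h₀; (hᵢ, vᵢ)]` over a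
1-dimensional base has function a.e. equal to `F · 1_{(0,1)}`, `F(x) = 1/x − log(1+x)/x²` (the fibre
function of the witness `r₀ = [(0,1)², t/(1+xt)]`), then on a full-measure open semialgebraic `U ⊆ σ ∩ (0,1)`
the identity `Σ hᵢ log vᵢ + x⁻² log(1+x) = x⁻¹ − h₀` holds with semialgebraic right-hand side, so descent
forces `h₀ = x⁻¹` a.e. on `(0,1)`, contradicting the termwise clause `IntegrableOn h₀ σ` of
`KZlog.Term.Admissible`.  Class: refuted-misstated (the witness is the fold of the inadmissible datum
`[(0,1); 1/x; (−1/x², 1+x)]`; a repaired statement must exclude zeros of the leading `t`-coefficient on the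
closure of the base, or regularise the log terms).

Provenance: workshop `decomp-kz`, lens 3 generation 8; landed by the critic seat (refuter lineage).
-/

noncomputable section

open Set MeasureTheory Filter Topology
open scoped BigOperators
open Literature.NumberTheory.Transcendental Literature.ModelTheory.ExponentialFields
open Summit.KontsevichZagierPeriods.KontsevichZagierPeriods.Theses.RootDecompRelativeModAbsolute

namespace Summit.KontsevichZagierPeriods.RootDecompRelativeModAbsolute

namespace LogFoldingDegOneNegative

/-- **MAIN THEOREM.** Log-linear descent refutes the degree-one folding item `LogFoldingDegOne`
(stmt-29577); witness `r₀ = [(0,1)², t/(1+xt)]`.  The hypothesis `hLLD` is, VERBATIM, the conclusion of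
the tree theorem `Summit.KontsevichZagierPeriods.LiouvilleUnfolding.LogPrimitiveNL.stub_descent`
(`Theorems/LiouvilleUnfoldingLogPrimitiveNLStubDescent.lean`), discharged in the tree by
`stub_descent stub_peelingStep stub_constRigidity`; it is kept as a hypothesis here so that this file does
not import that chain. -/
theorem not_logFoldingDegOne_of_logLinearDescent
    (hLLD :
      ∀ (n k : ℕ) (U : Set (Fin n → ℝ)) (h W : Fin k → (Fin n → ℝ) → ℝ) (g : (Fin n → ℝ) → ℝ),
      IsSemialgebraic ℚ U → (∀ i, IsSemialgebraicFunOn ℚ U (h i)) →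
      (∀ i, IsSemialgebraicFunOn ℚ U (W i)) → (∀ i, ∀ x ∈ U, 0 < W i x) →
      IsSemialgebraicFunOn ℚ U g → (∀ x ∈ U, ∑ i, h i x * Real.log (W i x) = g x) →
      ∃ (N : ℕ) (C : Fin N → Set (Fin n → ℝ)),
      (∀ c, IsSemialgebraic ℚ (C c) ∧ IsOpen (C c) ∧ C c ⊆ U) ∧
      Pairwise (Function.onFun Disjoint C) ∧ volume (U \ ⋃ c, C c) = 0 ∧
      ∀ c, (∀ x ∈ C c, g x = 0) ∧
      ∃ (R : ℕ) (f : Fin R → Fin k → ℤ) (q : Fin R → (Fin n → ℝ) → ℝ),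
      (∀ r, IsSemialgebraicFunOn ℚ (C c) (q r)) ∧
      (∀ r, ∀ x ∈ C c, ∏ i, W i x ^ (f r i) = 1) ∧
      (∀ i, ∀ x ∈ C c, h i x = ∑ r, q r x * (f r i : ℝ))) :
    ¬ LogFoldingDegOne := by
  intro hFold
  obtain ⟨T, -, hT⟩ := hFold cex cex_isRationalDegLE
  have hT' : ∀ᵐ x : Fin 1 → ℝ, box.indicator (fun x => F (x 0)) x = T.domain.indicator T.integrand x := by
    filter_upwards [hT] with x hx
    rw [← fibreIntegral_cex x]
    exact hx
  -- Step A: the box lies in `σ = T.domain` up to a null set (`F > 0` on `(0,1)`).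
  have hA : volume (box \ T.domain) = 0 := by
    have hae : ∀ᵐ x : Fin 1 → ℝ, x ∉ box \ T.domain := by
      filter_upwards [hT'] with x hx hmem
      rw [indicator_of_mem hmem.1, indicator_of_notMem hmem.2] at hx
      exact (F_pos hmem.1).ne' hx
    have := ae_iff.1 hae
    simpa only [not_not, setOf_mem_eq] using this
  -- Step B: regularity of the data of `T` on an open semialgebraic `G` of full measure in `σ`.
  obtain ⟨G, hGσ, hGo, hGs, hGn, hh₀c, hhc, hvc⟩ := exists_isOpen_continuousOn_data T
  -- Step C: on `U = G ∩ (0,1)` the identity `T-function = F` holds EVERYWHERE.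
  set U : Set (Fin 1 → ℝ) := G ∩ box with hUdef
  have hUo : IsOpen U := hGo.inter isOpen_box
  have hUs : IsSemialgebraic ℚ U := hGs.inter isSemialgebraic_box
  have hUσ : U ⊆ T.domain := fun x hx => hGσ hx.1
  have hUbox : U ⊆ box := fun x hx => hx.2
  have hpos : ∀ x ∈ U, (0 : ℝ) < x 0 := fun x hx => (hUbox hx).1
  have hcontT : ContinuousOn T.integrand U := by
    have e : T.integrand = fun x => T.h₀ x + ∑ i, T.h i x * Real.log (T.v i x) := rfl
    rw [e]
    refine (hh₀c.mono inter_subset_left).add (continuousOn_finsetSum _ fun i _ => ?_)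
    refine ((hhc i).mono inter_subset_left).mul
      (((hvc i).mono inter_subset_left).log fun x hx => ?_)
    exact (one_pos.trans_le (T.admissible.one_le_v i x (hUσ hx))).ne'
  have hcontF : ContinuousOn (fun x : Fin 1 → ℝ => F (x 0)) U :=
    continuousOn_F.comp ((continuous_apply 0).continuousOn) fun x hx => hUbox hx
  have hae : T.integrand =ᵐ[volume.restrict U] (fun x : Fin 1 → ℝ => F (x 0)) := by
    refine (ae_restrict_iff' hUo.measurableSet).2 (hT'.mono fun x hx hxU => ?_)
    rw [indicator_of_mem (hUbox hxU), indicator_of_mem (hUσ hxU)] at hx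
    exact hx.symm
  have hEq : EqOn T.integrand (fun x => F (x 0)) U :=
    Measure.eqOn_open_of_ae_eq hae hUo hcontT hcontF
  -- Step D: log-linear descent for `Σ hᵢ log vᵢ + x⁻² log(1+x) = x⁻¹ − h₀` on `U`.
  have hinv : IsSemialgebraicFunOn ℚ U (fun x : Fin 1 → ℝ => (x 0)⁻¹) := by
    have := isSemialgebraicFunOn_aeval_div_aeval (k := ℚ) hUs 1 (MvPolynomial.X 0)
      (fun x hx => by simpa only [MvPolynomial.aeval_X] using (hpos x hx).ne')
    refine this.congr fun x _ => ?_
    simp only [map_one, MvPolynomial.aeval_X, one_div]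
  have hinv2 : IsSemialgebraicFunOn ℚ U (fun x : Fin 1 → ℝ => (x 0)⁻¹ ^ 2) := by
    have := isSemialgebraicFunOn_aeval_div_aeval (k := ℚ) hUs 1 (MvPolynomial.X 0 ^ 2)
      (fun x hx => by
        simpa only [map_pow, MvPolynomial.aeval_X] using (pow_pos (hpos x hx) 2).ne')
    refine this.congr fun x _ => ?_
    simp only [map_one, map_pow, MvPolynomial.aeval_X, one_div, inv_pow]
  have hlin : IsSemialgebraicFunOn ℚ U (fun x : Fin 1 → ℝ => 1 + x 0) := by
    refine (isSemialgebraicFunOn_aeval (k := ℚ) hUs (1 + MvPolynomial.X 0)).congr fun x _ => ?_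
    simp only [map_add, map_one, MvPolynomial.aeval_X]
  have hg : IsSemialgebraicFunOn ℚ U (fun x : Fin 1 → ℝ => (x 0)⁻¹ - T.h₀ x) :=
    IsSemialgebraicFunOn.sub_holds hinv (T.admissible.isSemialgebraicFunOn_h₀.mono hUσ hUs)
  obtain ⟨N, C, hC, -, hnull, hcell⟩ := hLLD 1 (T.k + 1) U
      (Fin.snoc T.h fun x => (x 0)⁻¹ ^ 2) (Fin.snoc T.v fun x => 1 + x 0)
      (fun x => (x 0)⁻¹ - T.h₀ x) hUs
      (by
        intro i
        induction i using Fin.lastCases with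
        | last => simpa only [Fin.snoc_last] using hinv2
        | cast j =>
          simpa only [Fin.snoc_castSucc] using (T.admissible.isSemialgebraicFunOn_h j).mono hUσ hUs)
      (by
        intro i
        induction i using Fin.lastCases with
        | last => simpa only [Fin.snoc_last] using hlin
        | cast j =>
          simpa only [Fin.snoc_castSucc] using (T.admissible.isSemialgebraicFunOn_v j).mono hUσ hUs)
      (by
        intro i x hx
        induction i using Fin.lastCases with
        | last =>
          simp only [Fin.snoc_last]
          linarith [hpos x hx]
        | cast j =>
          simp only [Fin.snoc_castSucc]
          exact one_pos.trans_le (T.admissible.one_le_v j x (hUσ hx)))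
      hg
      (by
        intro x hx
        rw [Fin.sum_univ_castSucc]
        simp only [Fin.snoc_castSucc, Fin.snoc_last]
        have h1 := hEq hx
        simp only [KZlog.Term.integrand_apply, F] at h1
        linarith)
  -- Step E: hence `h₀ = x⁻¹` almost everywhere on `U`.
  have hE : ∀ᵐ x ∂(volume.restrict U), T.h₀ x = (x 0)⁻¹ := by
    rw [ae_restrict_iff' hUo.measurableSet, ae_iff]
    refine measure_mono_null (fun x hx => ?_) hnull
    rw [mem_setOf_eq, Classical.not_imp] at hx
    refine ⟨hx.1, fun hmem => hx.2 ?_⟩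
    obtain ⟨c, hc⟩ := mem_iUnion.1 hmem
    have := (hcell c).1 x hc
    linarith
  -- Step F: so `x⁻¹` would be integrable on `U`, i.e. on the box `(0,1)`: contradiction.
  have hF1 : IntegrableOn (fun x : Fin 1 → ℝ => (x 0)⁻¹) U :=
    (T.admissible.integrableOn_h₀.mono_set hUσ).congr_fun_ae hE
  have hUbox_ae : box =ᵐ[volume] U := by
    refine ae_eq_set.2 ⟨?_, ?_⟩
    · refine measure_mono_null (fun x hx => ?_) (measure_union_null hA hGn)
      by_cases hxσ : x ∈ T.domain
      · exact Or.inr ⟨hxσ, fun hxG => hx.2 ⟨hxG, hx.1⟩⟩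
      · exact Or.inl ⟨hx.1, hxσ⟩
    · rw [Set.sdiff_eq_empty.2 hUbox, measure_empty]
  exact not_integrableOn_inv_box (hF1.congr_set_ae hUbox_ae)

end LogFoldingDegOneNegative

end Summit.KontsevichZagierPeriods.RootDecompRelativeModAbsolute

end
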